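import Literature.Geometry.GeometricMeasureTheory.HausdorffDensity
import Mathlib.Analysis.InnerProductSpace.Orientation

/-!
# Sums of rectifiable currents of integration

Towards "𝓡_{m,K}(U) is an additive subgroup" [Federer1969, 4.1.24] for the tree's concrete class
of currents of integration `[W, θ, ξ]` with admissible data (`IsRectifiableData`, after 4.1.28 (4)):

* `frameVector_eq_or_eq_neg_of_span_eq` — orthonormal frames with the same span have the same
  simple `m`-vector up to sign (determinant of the orthogonal change of basis);
* `vectorCurrent_congr_ae`, `vectorCurrent_add`, `vectorCurrent_indicator`,
  `currentOfIntegration_eq_vectorCurrent_indicator`, `currentOfIntegration_add_multiplicity`,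
  `IsCountablyRectifiable.union` — API of `μ ∧ η` and `[W, θ, ξ]`;
* `IsRectifiableData.add` — **the sum of two currents of integration with admissible data is a
  current of integration with admissible data over `W₁ ∪ W₂`**, provided `𝓗^m ⌞ W₁` and
  `𝓗^m ⌞ W₂` are locally finite: on the overlap the approximate tangent planes agree a.e.
  (`ae_approxTangentCone_union_eq`, Federer 2.10.19 (4)), so the frames agree up to a sign `ε(x)`
  and the multiplicity of the sum is `θ₁ + ε θ₂`. (For Federer's `𝓡_m` the local finiteness is
  automatic after shrinking the carrier to `{θ ≠ 0}`; re-establishing the tangent-plane condition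
  on the shrunk carrier is his 3.2.19, not formalised here.)

Source: H. Federer, *Geometric Measure Theory*, Springer 1969 (`Federer1969`), 4.1.24, 4.1.28,
2.10.19 (4), 3.2.16 (held copy `lit book:federernd-geometric-measure-theory`, PDF pp. 158–159, 216,
321–326).
-/

open scoped Distributions ENNReal NNReal Topology
open MeasureTheory TopologicalSpace Set Filter Module

namespace Literature.Geometry.GeometricMeasureTheory

-- Depth 3 (not 2 as in `Currents.lean`): with 2, `Integrable.add`-type lemmas for
-- `Multivector`-valued functions leave an `ESeminormedAddMonoid` problem pending and time out.
set_option maxSynthPendingDepth 3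

/-! ### Frame alignment: orthonormal frames with the same span have the same simple `m`-vector
up to sign -/

section Alignment

variable {V : Type*} [NormedAddCommGroup V] [InnerProductSpace ℝ V] {m : ℕ}

/-- **Orthonormal frames spanning the same `m`-plane define the same simple `m`-vector up to
sign**: `w₁ ∧ ⋯ ∧ wₘ = ± v₁ ∧ ⋯ ∧ vₘ`, the sign being the determinant of the (orthogonal)
change-of-basis matrix ("η(x) is simple … Tan^m … is associated with η(x)" determines `η(x)` up to
sign and modulus). [cite: Federer1969, 1.6.1 with 4.1.28 (4)] -/
theorem frameVector_eq_or_eq_neg_of_span_eq {v w : Fin m → V} (hv : Orthonormal ℝ v)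
    (hw : Orthonormal ℝ w)
    (h : Submodule.span ℝ (Set.range w) = Submodule.span ℝ (Set.range v)) :
    frameVector w = frameVector v ∨ frameVector w = -frameVector v := by
  classical
  cases m with
  | zero =>
    left
    have : w = v := funext fun i => i.elim0
    rw [this]
  | succ k =>
    -- an orthonormal basis `a` of `P = span v` from `v`
    let a₀ : Basis (Fin (k + 1)) ℝ (Submodule.span ℝ (Set.range v)) := Basis.span hv.linearIndependent
    have ha₀ : ∀ i, (a₀ i : V) = v i := fun i =>
      congrArg Subtype.val (Basis.span_apply hv.linearIndependent i)
    have ha₀on : Orthonormal ℝ a₀ := by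
      rw [orthonormal_iff_ite] at hv ⊢
      intro i j
      rw [Submodule.coe_inner, ha₀, ha₀]
      exact hv i j
    let a : OrthonormalBasis (Fin (k + 1)) ℝ (Submodule.span ℝ (Set.range v)) :=
      a₀.toOrthonormalBasis ha₀on
    have ha : ∀ i, (a i : V) = v i := fun i => by
      change ((a₀.toOrthonormalBasis ha₀on) i : V) = v i
      rw [Basis.coe_toOrthonormalBasis, ha₀]
    -- `w` as an orthonormal basis `b` of `P`
    have hwP : ∀ i, w i ∈ Submodule.span ℝ (Set.range v) := fun i =>
      h ▸ Submodule.subset_span (Set.mem_range_self i)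
    let w' : Fin (k + 1) → Submodule.span ℝ (Set.range v) := fun i => ⟨w i, hwP i⟩
    have hw'on : Orthonormal ℝ w' := by
      rw [orthonormal_iff_ite] at hw ⊢
      intro i j
      rw [Submodule.coe_inner]
      exact hw i j
    have hcard : Fintype.card (Fin (k + 1)) = Module.finrank ℝ (Submodule.span ℝ (Set.range v)) := by
      rw [finrank_span_eq_card hv.linearIndependent]
    let b₀ : Basis (Fin (k + 1)) ℝ (Submodule.span ℝ (Set.range v)) :=
      basisOfOrthonormalOfCardEqFinrank hw'on hcard
    have hb₀ : (b₀ : Fin (k + 1) → Submodule.span ℝ (Set.range v)) = w' :=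
      coe_basisOfOrthonormalOfCardEqFinrank hw'on hcard
    let b : OrthonormalBasis (Fin (k + 1)) ℝ (Submodule.span ℝ (Set.range v)) :=
      b₀.toOrthonormalBasis (by rw [hb₀]; exact hw'on)
    have hb : ∀ i, (b i : V) = w i := fun i => by
      change ((b₀.toOrthonormalBasis _) i : V) = w i
      rw [Basis.coe_toOrthonormalBasis, hb₀]
    -- every covector sees `w` as `det · v`
    have key : ∀ φ : Covector V (k + 1), φ w = φ v * a.toBasis.det b := by
      intro φ
      let ψ : (Submodule.span ℝ (Set.range v)) [⋀^Fin (k + 1)]→ₗ[ℝ] ℝ :=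
        φ.toAlternatingMap.compLinearMap (Submodule.span ℝ (Set.range v)).subtype
      have h1 := AlternatingMap.eq_smul_basis_det a.toBasis ψ
      have h2 := congrArg (fun f : (Submodule.span ℝ (Set.range v)) [⋀^Fin (k + 1)]→ₗ[ℝ] ℝ => f b) h1
      simp only [AlternatingMap.smul_apply, smul_eq_mul] at h2
      have e1 : ψ (⇑b) = φ w := by
        change φ (fun i => (Submodule.span ℝ (Set.range v)).subtype (b i)) = φ w
        congr 1
        funext i
        exact hb i
      have e2 : ψ (⇑a.toBasis) = φ v := by
        change φ (fun i => (Submodule.span ℝ (Set.range v)).subtype (a.toBasis i)) = φ v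
        congr 1
        funext i
        rw [OrthonormalBasis.coe_toBasis]
        exact ha i
      rw [← e1, h2, e2]
    rcases OrthonormalBasis.det_to_matrix_orthonormalBasis_real a b with hd | hd
    · left
      ext φ
      simp [frameVector_apply, key φ, hd]
    · right
      ext φ
      simp [frameVector_apply, key φ, hd]

end Alignment

/-! ### Currents `μ ∧ η`: a.e. congruence, additivity, indicators -/

section VectorCurrentAPI

variable {E : Type*} [NormedAddCommGroup E] [NormedSpace ℝ E] [MeasurableSpace E]
  [OpensMeasurableSpace E] {Ω : Opens E} {m : ℕ}

/-- `μ ∧ η₁ = μ ∧ η₂` when `η₁ = η₂` `μ`-almost everywhere. [cite: Federer1969, 4.1.7] -/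
theorem vectorCurrent_congr_ae {μ : Measure E} {η₁ η₂ : E → Multivector E m} (h : η₁ =ᵐ[μ] η₂) :
    (vectorCurrent μ η₁ : Current Ω m) = vectorCurrent μ η₂ := by
  by_cases h₁ : LocallyIntegrableOn η₁ (Ω : Set E) μ
  · have h₂ : LocallyIntegrableOn η₂ (Ω : Set E) μ := h₁.congr (ae_restrict_of_ae h)
    ext φ
    rw [vectorCurrent_apply h₁, vectorCurrent_apply h₂]
    exact integral_congr_ae (h.mono fun x hx => by simp only [hx])
  · have h₂ : ¬ LocallyIntegrableOn η₂ (Ω : Set E) μ := fun h₂ =>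
      h₁ (h₂.congr (ae_restrict_of_ae h.symm))
    rw [vectorCurrent_of_not_locallyIntegrableOn h₁, vectorCurrent_of_not_locallyIntegrableOn h₂]

/-- `μ ∧ (η₁ + η₂) = μ ∧ η₁ + μ ∧ η₂` for locally integrable `η₁, η₂`. [cite: Federer1969, 4.1.7] -/
theorem vectorCurrent_add {μ : Measure E} {η₁ η₂ : E → Multivector E m}
    (h₁ : LocallyIntegrableOn η₁ (Ω : Set E) μ) (h₂ : LocallyIntegrableOn η₂ (Ω : Set E) μ) :
    (vectorCurrent μ (η₁ + η₂) : Current Ω m) = vectorCurrent μ η₁ + vectorCurrent μ η₂ := by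
  ext φ
  have hi₁ := TestFunction.integrable_bilin (covectorPairing E m) h₁ φ
  have hi₂ := TestFunction.integrable_bilin (covectorPairing E m) h₂ φ
  simp only [covectorPairing_apply] at hi₁ hi₂
  change vectorCurrent μ (η₁ + η₂) φ = vectorCurrent μ η₁ φ + vectorCurrent μ η₂ φ
  rw [vectorCurrent_apply (h₁.add h₂), vectorCurrent_apply h₁, vectorCurrent_apply h₂]
  have e : (fun x => (η₁ + η₂) x (φ x)) = fun x => η₁ x (φ x) + η₂ x (φ x) := by
    funext x
    rfl
  rw [e]
  exact integral_add hi₁ hi₂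

omit [OpensMeasurableSpace E] in
/-- Local integrability of `s.indicator η` with respect to `μ` is local integrability of `η` with
respect to `μ ⌞ s`. [folklore] -/
theorem locallyIntegrableOn_indicator_iff {μ : Measure E} {η : E → Multivector E m} {s : Set E}
    (hs : MeasurableSet s) :
    LocallyIntegrableOn (s.indicator η) (Ω : Set E) μ ↔
      LocallyIntegrableOn η (Ω : Set E) (μ.restrict s) := by
  have key : ∀ U : Set E, IntegrableOn (s.indicator η) U μ ↔ IntegrableOn η U (μ.restrict s) := by
    intro U
    have h1 := integrable_indicator_iff (f := η) (μ := μ.restrict U) hs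
    rw [IntegrableOn, Measure.restrict_restrict hs] at h1
    rw [IntegrableOn, IntegrableOn, Measure.restrict_restrict' hs, inter_comm]
    exact h1
  constructor
  · intro h x hx
    obtain ⟨U, hU, hint⟩ := h x hx
    exact ⟨U, hU, (key U).1 hint⟩
  · intro h x hx
    obtain ⟨U, hU, hint⟩ := h x hx
    exact ⟨U, hU, (key U).2 hint⟩

/-- **`μ ∧ (s.indicator η) = (μ ⌞ s) ∧ η`** (including the junk case). [cite: Federer1969, 4.1.7] -/
theorem vectorCurrent_indicator {μ : Measure E} (η : E → Multivector E m) {s : Set E}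
    (hs : MeasurableSet s) :
    (vectorCurrent μ (s.indicator η) : Current Ω m) = vectorCurrent (μ.restrict s) η := by
  by_cases h : LocallyIntegrableOn η (Ω : Set E) (μ.restrict s)
  · have h' : LocallyIntegrableOn (s.indicator η) (Ω : Set E) μ :=
      (locallyIntegrableOn_indicator_iff hs).2 h
    ext φ
    rw [vectorCurrent_apply h', vectorCurrent_apply h, ← integral_indicator hs]
    congr 1
    funext x
    by_cases hx : x ∈ s <;> simp [hx]
  · have h' : ¬ LocallyIntegrableOn (s.indicator η) (Ω : Set E) μ := fun h' =>
      h ((locallyIntegrableOn_indicator_iff hs).1 h')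
    rw [vectorCurrent_of_not_locallyIntegrableOn h, vectorCurrent_of_not_locallyIntegrableOn h']

end VectorCurrentAPI

section IntegrationAPI

variable {V : Type*} [NormedAddCommGroup V] [NormedSpace ℝ V] [MeasurableSpace V] [BorelSpace V]
  {Ω : Opens V} {m : ℕ}

/-- `[W, θ, ξ] = 𝓗^m ∧ (W.indicator (θ ξ))`: a current of integration over a measurable carrier is
the ambient Hausdorff measure wedged with the extended-by-zero density.
[cite: Federer1969, 4.1.28 (4) with 4.1.7] -/
theorem currentOfIntegration_eq_vectorCurrent_indicator {W : Set V} (hW : MeasurableSet W)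
    (θ : V → ℤ) (ξ : V → Fin m → V) :
    (currentOfIntegration W θ ξ : Current Ω m) =
      vectorCurrent (μHE[m] : Measure V) (W.indicator fun x => (θ x : ℝ) • frameVector (ξ x)) :=
  (vectorCurrent_indicator _ hW).symm

/-- `[W, θ₁ + θ₂, ξ] = [W, θ₁, ξ] + [W, θ₂, ξ]` for locally `𝓗^m ⌞ W`-integrable densities.
[cite: Federer1969, 4.1.28 (4) with 4.1.7] -/
theorem currentOfIntegration_add_multiplicity {W : Set V} {θ₁ θ₂ : V → ℤ} {ξ : V → Fin m → V}
    (h₁ : LocallyIntegrableOn (fun x => (θ₁ x : ℝ) • frameVector (ξ x)) (Ω : Set V)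
      ((μHE[m] : Measure V).restrict W))
    (h₂ : LocallyIntegrableOn (fun x => (θ₂ x : ℝ) • frameVector (ξ x)) (Ω : Set V)
      ((μHE[m] : Measure V).restrict W)) :
    (currentOfIntegration W (fun x => θ₁ x + θ₂ x) ξ : Current Ω m) =
      currentOfIntegration W θ₁ ξ + currentOfIntegration W θ₂ ξ := by
  unfold currentOfIntegration
  rw [← vectorCurrent_add h₁ h₂]
  congr 1
  funext x
  simp only [Pi.add_apply, Int.cast_add, add_smul]

omit [NormedSpace ℝ V] in
/-- The union of two countably `m`-rectifiable sets is countably `m`-rectifiable (interleave the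
two sequences of Lipschitz maps). [cite: Federer1969, 3.2.14] -/
theorem IsCountablyRectifiable.union {W₁ W₂ : Set V} (h₁ : IsCountablyRectifiable m W₁)
    (h₂ : IsCountablyRectifiable m W₂) : IsCountablyRectifiable m (W₁ ∪ W₂) := by
  obtain ⟨f₁, hf₁, h0₁⟩ := h₁
  obtain ⟨f₂, hf₂, h0₂⟩ := h₂
  refine ⟨fun n => if n % 2 = 0 then f₁ (n / 2) else f₂ (n / 2), fun n => ?_, ?_⟩
  · by_cases hn : n % 2 = 0
    · simp only [hn, if_true]; exact hf₁ _
    · simp only [hn, if_false]; exact hf₂ _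
  · refine measure_mono_null ?_ (measure_union_null h0₁ h0₂)
    rintro x ⟨hx, hxU⟩
    simp only [mem_iUnion, not_exists] at hxU
    rcases hx with hx | hx
    · left
      refine ⟨hx, ?_⟩
      simp only [mem_iUnion, not_exists]
      intro i hi
      refine hxU (2 * i) ?_
      simpa using hi
    · right
      refine ⟨hx, ?_⟩
      simp only [mem_iUnion, not_exists]
      intro i hi
      refine hxU (2 * i + 1) ?_
      have e1 : (2 * i + 1) % 2 = 1 := by omega
      have e2 : (2 * i + 1) / 2 = i := by omega
      simp [e1, e2, hi]

end IntegrationAPI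




/-! ### Additivity of admissible data with locally finite carriers -/

section Additivity

variable {V : Type*} [NormedAddCommGroup V] [InnerProductSpace ℝ V] [FiniteDimensional ℝ V]
  [MeasurableSpace V] [BorelSpace V] {Ω : Opens V} {m : ℕ}

/-- **Sums of currents of integration with admissible data.** If `[W₁, θ₁, ξ₁]` and `[W₂, θ₂, ξ₂]`
have admissible data and `𝓗^m ⌞ W₁`, `𝓗^m ⌞ W₂` are locally finite, then
`[W₁, θ₁, ξ₁] + [W₂, θ₂, ξ₂] = [W₁ ∪ W₂, θ, ξ]` for admissible data `(W₁ ∪ W₂, θ, ξ)`: `ξ = ξ₁` on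
`W₁` and `ξ₂` elsewhere, `θ = θ₁ + ε θ₂` on `W₁ ∩ W₂` (where `ξ₂₁ ∧ ⋯ ∧ ξ₂ₘ = ε ξ₁₁ ∧ ⋯ ∧ ξ₁ₘ`
almost everywhere, `ε = ±1`), `θ₁` on `W₁ ∖ W₂`, `θ₂` on `W₂ ∖ W₁`.
[cite: Federer1969, 4.1.24 ("𝓡_{m,K}(U) is an additive subgroup") with 4.1.28 (4), 2.10.19 (4)] -/
theorem IsRectifiableData.add {W₁ W₂ : Set V} {θ₁ θ₂ : V → ℤ} {ξ₁ ξ₂ : V → Fin m → V}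
    (h₁ : IsRectifiableData Ω m W₁ θ₁ ξ₁) (h₂ : IsRectifiableData Ω m W₂ θ₂ ξ₂)
    [IsLocallyFiniteMeasure ((μHE[m] : Measure V).restrict W₁)]
    [IsLocallyFiniteMeasure ((μHE[m] : Measure V).restrict W₂)] :
    ∃ (θ : V → ℤ) (ξ : V → Fin m → V), IsRectifiableData Ω m (W₁ ∪ W₂) θ ξ ∧
      (currentOfIntegration (W₁ ∪ W₂) θ ξ : Current Ω m) =
        currentOfIntegration W₁ θ₁ ξ₁ + currentOfIntegration W₂ θ₂ ξ₂ := by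
  classical
  obtain ⟨hW₁m, hW₁Ω, hW₁r, hint₁, hae₁⟩ := h₁
  obtain ⟨hW₂m, hW₂Ω, hW₂r, hint₂, hae₂⟩ := h₂
  -- the data of the sum
  let ε : V → ℤ := fun x => if frameVector (ξ₂ x) = frameVector (ξ₁ x) then 1 else -1
  let ξ : V → Fin m → V := fun x => if x ∈ W₁ then ξ₁ x else ξ₂ x
  let θ : V → ℤ := fun x =>
    if x ∈ W₁ then (if x ∈ W₂ then θ₁ x + ε x * θ₂ x else θ₁ x) else θ₂ x
  -- tangent cones of the union agree with those of the pieces, almost everywhere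
  have T₁ : ∀ᵐ x ∂(μHE[m] : Measure V).restrict W₁,
      approxTangentCone m ((μHE[m] : Measure V).restrict (W₁ ∪ W₂)) x =
        approxTangentCone m ((μHE[m] : Measure V).restrict W₁) x :=
    ae_approxTangentCone_union_eq hW₁m hW₂m
  have T₂ : ∀ᵐ x ∂(μHE[m] : Measure V).restrict W₂,
      approxTangentCone m ((μHE[m] : Measure V).restrict (W₁ ∪ W₂)) x =
        approxTangentCone m ((μHE[m] : Measure V).restrict W₂) x := by
    rw [union_comm]
    exact ae_approxTangentCone_union_eq hW₂m hW₁m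
  -- frame alignment on the overlap, almost everywhere
  have A : ∀ᵐ x ∂(μHE[m] : Measure V).restrict (W₁ ∩ W₂),
      frameVector (ξ₂ x) = frameVector (ξ₁ x) ∨ frameVector (ξ₂ x) = -frameVector (ξ₁ x) := by
    have le₁ : (μHE[m] : Measure V).restrict (W₁ ∩ W₂) ≤ (μHE[m] : Measure V).restrict W₁ :=
      Measure.restrict_mono inter_subset_left le_rfl
    have le₂ : (μHE[m] : Measure V).restrict (W₁ ∩ W₂) ≤ (μHE[m] : Measure V).restrict W₂ :=
      Measure.restrict_mono inter_subset_right le_rfl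
    filter_upwards [ae_mono le₁ hae₁, ae_mono le₂ hae₂, ae_mono le₁ T₁, ae_mono le₂ T₂]
      with x hx₁ hx₂ hT₁ hT₂
    refine frameVector_eq_or_eq_neg_of_span_eq hx₁.1 hx₂.1 ?_
    rw [← SetLike.coe_set_eq, hx₂.2, hx₁.2, ← hT₁, ← hT₂]
  -- the density of the sum is the sum of the extended densities, almost everywhere
  have K : (W₁ ∪ W₂).indicator (fun x => (θ x : ℝ) • frameVector (ξ x)) =ᵐ[(μHE[m] : Measure V)]
      W₁.indicator (fun x => (θ₁ x : ℝ) • frameVector (ξ₁ x)) +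
        W₂.indicator (fun x => (θ₂ x : ℝ) • frameVector (ξ₂ x)) := by
    filter_upwards [(ae_restrict_iff' (hW₁m.inter hW₂m)).1 A] with x hx
    rw [Pi.add_apply]
    by_cases hx₁ : x ∈ W₁ <;> by_cases hx₂ : x ∈ W₂
    · rw [indicator_of_mem (show x ∈ W₁ ∪ W₂ from Or.inl hx₁), indicator_of_mem hx₁,
        indicator_of_mem hx₂]
      simp only [θ, ξ, if_pos hx₁, if_pos hx₂]
      by_cases he : frameVector (ξ₂ x) = frameVector (ξ₁ x)
      · have hε : ε x = 1 := if_pos he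
        rw [hε, he]
        push_cast
        module
      · have hε : ε x = -1 := if_neg he
        have he' : frameVector (ξ₂ x) = -frameVector (ξ₁ x) := (hx ⟨hx₁, hx₂⟩).resolve_left he
        rw [hε, he']
        push_cast
        module
    · rw [indicator_of_mem (show x ∈ W₁ ∪ W₂ from Or.inl hx₁), indicator_of_mem hx₁,
        indicator_of_notMem hx₂, add_zero]
      simp only [θ, ξ, if_pos hx₁, if_neg hx₂]
    · rw [indicator_of_mem (show x ∈ W₁ ∪ W₂ from Or.inr hx₂), indicator_of_notMem hx₁,
        indicator_of_mem hx₂, zero_add]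
      simp only [θ, ξ, if_neg hx₁]
    · have hx' : x ∉ W₁ ∪ W₂ := fun h => h.elim hx₁ hx₂
      rw [indicator_of_notMem hx', indicator_of_notMem hx₁, indicator_of_notMem hx₂, add_zero]
  -- local integrability of the pieces and of the sum
  have I₁ : LocallyIntegrableOn (W₁.indicator fun x => (θ₁ x : ℝ) • frameVector (ξ₁ x))
      (Ω : Set V) (μHE[m] : Measure V) := (locallyIntegrableOn_indicator_iff hW₁m).2 hint₁
  have I₂ : LocallyIntegrableOn (W₂.indicator fun x => (θ₂ x : ℝ) • frameVector (ξ₂ x))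
      (Ω : Set V) (μHE[m] : Measure V) := (locallyIntegrableOn_indicator_iff hW₂m).2 hint₂
  have I : LocallyIntegrableOn (fun x => (θ x : ℝ) • frameVector (ξ x)) (Ω : Set V)
      ((μHE[m] : Measure V).restrict (W₁ ∪ W₂)) :=
    (locallyIntegrableOn_indicator_iff (hW₁m.union hW₂m)).1 ((I₁.add I₂).congr
      (ae_restrict_of_ae K.symm))
  refine ⟨θ, ξ, ⟨hW₁m.union hW₂m, union_subset hW₁Ω hW₂Ω, hW₁r.union hW₂r, I, ?_⟩, ?_⟩
  · -- the frame condition on `W₁ ∪ W₂ = W₁ ⊔ (W₂ ∖ W₁)`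
    have hsplit : (μHE[m] : Measure V).restrict (W₁ ∪ W₂) =
        (μHE[m] : Measure V).restrict W₁ + (μHE[m] : Measure V).restrict (W₂ \ W₁) := by
      rw [← Measure.restrict_union disjoint_sdiff_right (hW₂m.diff hW₁m), Set.union_sdiff_self]
    rw [hsplit, ae_add_measure_iff]
    constructor
    · filter_upwards [ae_restrict_mem hW₁m, hae₁, T₁] with x hx h hT
      simp only [ξ, if_pos hx]
      rw [← hsplit]
      exact ⟨h.1, h.2.trans hT.symm⟩
    · have le₂ : (μHE[m] : Measure V).restrict (W₂ \ W₁) ≤ (μHE[m] : Measure V).restrict W₂ :=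
        Measure.restrict_mono Set.sdiff_subset le_rfl
      filter_upwards [ae_restrict_mem (hW₂m.diff hW₁m), ae_mono le₂ hae₂, ae_mono le₂ T₂]
        with x hx h hT
      simp only [ξ, if_neg hx.2]
      rw [← hsplit]
      exact ⟨h.1, h.2.trans hT.symm⟩
  · -- the currents
    rw [currentOfIntegration_eq_vectorCurrent_indicator (hW₁m.union hW₂m),
      currentOfIntegration_eq_vectorCurrent_indicator hW₁m,
      currentOfIntegration_eq_vectorCurrent_indicator hW₂m, vectorCurrent_congr_ae K,
      vectorCurrent_add I₁ I₂]

/-- The sum of two currents of integration with admissible data and locally finite carriers is a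
locally rectifiable current. [cite: Federer1969, 4.1.24 with 4.1.28 (4)] -/
theorem isLocallyRectifiable_add_of_isRectifiableData {W₁ W₂ : Set V} {θ₁ θ₂ : V → ℤ}
    {ξ₁ ξ₂ : V → Fin m → V} (h₁ : IsRectifiableData Ω m W₁ θ₁ ξ₁)
    (h₂ : IsRectifiableData Ω m W₂ θ₂ ξ₂)
    [IsLocallyFiniteMeasure ((μHE[m] : Measure V).restrict W₁)]
    [IsLocallyFiniteMeasure ((μHE[m] : Measure V).restrict W₂)] :
    (currentOfIntegration W₁ θ₁ ξ₁ + currentOfIntegration W₂ θ₂ ξ₂ : Current Ω m).IsLocallyRectifiable := by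
  obtain ⟨θ, ξ, h, hT⟩ := h₁.add h₂
  exact ⟨W₁ ∪ W₂, θ, ξ, h, hT.symm⟩

end Additivity

/-! ### Supports of sums -/

section SupportAdd

variable {E : Type*} [NormedAddCommGroup E] [NormedSpace ℝ E] {Ω : Opens E} {m : ℕ}

/-- `spt (S + T) ⊆ spt S ∪ spt T`. [cite: Federer1969, 4.1.1] -/
theorem Current.support_add_subset (S T : Current Ω m) : (S + T).support ⊆ S.support ∪ T.support := by
  intro x hx
  by_contra hx'
  simp only [mem_union, not_or] at hx'
  obtain ⟨U₁, hU₁, h₁⟩ := S.exists_nhds_of_not_mem_support hx.1 hx'.1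
  obtain ⟨U₂, hU₂, h₂⟩ := T.exists_nhds_of_not_mem_support hx.1 hx'.2
  obtain ⟨φ, hφ, hne⟩ := hx.2 (U₁ ∩ U₂) (inter_mem hU₁ hU₂)
  apply hne
  change S φ + T φ = 0
  rw [h₁ φ (hφ.trans inter_subset_left), h₂ φ (hφ.trans inter_subset_right), add_zero]

/-- The support of a current is `Ω ∩ C` for a closed `C`; hence a support contained in a compact
subset of `Ω` is compact. [cite: Federer1969, 4.1.1] -/
theorem Current.isCompact_support_of_subset (T : Current Ω m) {K : Set E} (hK : IsCompact K)
    (hKΩ : K ⊆ (Ω : Set E)) (h : T.support ⊆ K) : IsCompact T.support := by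
  have hclosed : IsClosed (T.support ∪ (Ω : Set E)ᶜ) := by
    rw [← isOpen_compl_iff, compl_union, compl_compl, inter_comm]
    exact T.isOpen_sdiff_support
  have heq : T.support = (T.support ∪ (Ω : Set E)ᶜ) ∩ K := by
    apply Subset.antisymm
    · exact fun x hx => ⟨Or.inl hx, h hx⟩
    · rintro x ⟨hx | hx, hxK⟩
      · exact hx
      · exact (hx (hKΩ hxK)).elim
  rw [heq]
  exact hK.inter_left hclosed

/-- `𝓡_m` is closed under sums whose summands are given by admissible data with locally finite
carriers. [cite: Federer1969, 4.1.24 with 4.1.28 (4)] -/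
theorem isRectifiable_add_of_isRectifiableData {V : Type*} [NormedAddCommGroup V]
    [InnerProductSpace ℝ V] [FiniteDimensional ℝ V] [MeasurableSpace V] [BorelSpace V]
    {Ω : Opens V} {m : ℕ} {W₁ W₂ : Set V} {θ₁ θ₂ : V → ℤ} {ξ₁ ξ₂ : V → Fin m → V}
    (h₁ : IsRectifiableData Ω m W₁ θ₁ ξ₁) (h₂ : IsRectifiableData Ω m W₂ θ₂ ξ₂)
    [IsLocallyFiniteMeasure ((μHE[m] : Measure V).restrict W₁)]
    [IsLocallyFiniteMeasure ((μHE[m] : Measure V).restrict W₂)]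
    (hc₁ : IsCompact (currentOfIntegration W₁ θ₁ ξ₁ : Current Ω m).support)
    (hc₂ : IsCompact (currentOfIntegration W₂ θ₂ ξ₂ : Current Ω m).support) :
    (currentOfIntegration W₁ θ₁ ξ₁ + currentOfIntegration W₂ θ₂ ξ₂ : Current Ω m).IsRectifiable := by
  refine ⟨isLocallyRectifiable_add_of_isRectifiableData h₁ h₂, ?_⟩
  exact Current.isCompact_support_of_subset _ (hc₁.union hc₂)
    (union_subset (Current.support_subset _) (Current.support_subset _))
    (Current.support_add_subset _ _)

end SupportAdd

end Literature.Geometry.GeometricMeasureTheory
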